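import Summits.ResolutionOfSingularities.ResolutionOfSingularities.Theorems.UniversalCellsCampaignW82DifferentialCriterionRatFunc
import Summits.ResolutionOfSingularities.ResolutionOfSingularities.Theorems.UniversalCellsCampaignW82KollarCurveAnyField
import HarnessLib

/-!
# [OURS · L1 W8.2] The 1-form `dt` VANISHES at Kollár's regular inseparable point: on `y^q = x^p − t` over `k(t)`,
# `dt = d(x^p − y^q) = −q y^{q−1} dy ∈ 𝔪_P Ω` at `P = (x^p − t, y)` — the (E6) witness of non-smoothness

Cell `res-hironaka` (run/shared/lean/pub/res-hironaka/), LADDER-RESOLUTION rung L (RESCUE), slot W8.2; host route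
`UniversalCells`, host item `PrimeFieldToPerfect` (stmt-ResolutionOfSingularities-15233), door 1. Proofs file
(Theses-free), written by res-L1-s82-pv-1 (gen 7); a worked instance of `…DifferentialCriterionRatFunc` on the
campaign's standing witness, Kollár's curve `C : y^q = x^p − t` over `k(t)` (`…KollarCurveAnyField`, gen 3: `C` is
REGULAR at `P = (x^p − t, y)`, `κ(P) = k(t^{1/p})`).

* `KollarCurveAnyField.algebraMap_X_eq` — in the coordinate ring `A = k(t)[x,y]/(y^q − x^p + t)` the constant `t`
  equals `x^p − y^q`.
* **`KollarCurveAnyField.tmul_D_t_eq_zero`** — ANY field `k` of characteristic `p`, `q > 1`: in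
  `κ(P) ⊗ Ω_{A_P/k}` one has `1 ⊗ dt = 0` (`dt = d(x^p − y^q) = p x^{p−1} dx − q y^{q−1} dy = −q y^{q−1} dy`, and
  `y ∈ 𝔪_P`): THE 1-FORM `dt` HAS A ZERO AT THE REGULAR POINT `P`.
* **`KollarCurveAnyField.not_formallySmooth_of_isLocalization_kollarPoint`** — hence (`k` perfect, (E6)
  `ratFunc_formallySmooth_iff_tmul_D_ne_zero`) the local ring `A_P` is NOT formally smooth over `k(t)`: the zero of
  `dt` IS a non-smooth point of the regular curve `C` (non-smoothness of `C` was gen 3/6's `not_smooth_f₀` by other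
  routes; here it is READ OFF the 1-form). Both statements are made for an arbitrary model `B` of `A_P`
  (`IsLocalization.AtPrime B P`) to keep instance search off the concrete localization type.

HONEST FRAMING. OURS theorems (a computation); NOT statements of [Hironaka2017]; nothing attributed to its author.
AI work, weaker than expert review; no claim beyond the kernel. No `sorry`, no new axioms.
-/

noncomputable section

set_option linter.dupNamespace false -- mandated namespace of this single-conjunct summit

open IsLocalRing TensorProduct KaehlerDifferential
open scoped RatFunc

namespace Summit.ResolutionOfSingularities.ResolutionOfSingularities.Theorems.CampaignW82.KollarCurveAnyField

variable (k : Type) [Field k] (p : ℕ) [Fact p.Prime] (q : ℕ)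

omit [Fact p.Prime] in
/-- In `A = k(t)[x,y]/(y^q − x^p + t)`: `t = x^p − y^q`. [folklore] -/
theorem algebraMap_X_eq :
    algebraMap (RatFunc k) (kollarRing k p q) RatFunc.X =
      Ideal.Quotient.mk (Ideal.span {kollarPoly k p q}) (MvPolynomial.X 0) ^ p -
        Ideal.Quotient.mk (Ideal.span {kollarPoly k p q}) (MvPolynomial.X 1) ^ q := by
  have h0 : Ideal.Quotient.mk (Ideal.span {kollarPoly k p q}) (kollarPoly k p q) = 0 :=
    Ideal.Quotient.eq_zero_iff_mem.mpr (Ideal.subset_span rfl)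
  have h1 : Ideal.Quotient.mk (Ideal.span {kollarPoly k p q}) (MvPolynomial.X 1) ^ q -
      Ideal.Quotient.mk (Ideal.span {kollarPoly k p q}) (MvPolynomial.X 0) ^ p +
        Ideal.Quotient.mk (Ideal.span {kollarPoly k p q}) (MvPolynomial.C RatFunc.X) = 0 := by
    rw [← map_pow, ← map_pow, ← map_sub, ← map_add]
    exact h0
  have halg : algebraMap (RatFunc k) (kollarRing k p q) RatFunc.X =
      Ideal.Quotient.mk (Ideal.span {kollarPoly k p q}) (MvPolynomial.C RatFunc.X) := by
    rw [IsScalarTower.algebraMap_apply (RatFunc k) (MvPolynomial (Fin 2) (RatFunc k)) (kollarRing k p q),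
      MvPolynomial.algebraMap_eq, Ideal.Quotient.algebraMap_eq]
  rw [halg, eq_neg_of_add_eq_zero_right h1, neg_sub]

/-- `y ∈ 𝔭 = (x^p − t, y)`. [folklore] -/
theorem mk_X_one_mem_kollarPoint :
    Ideal.Quotient.mk (Ideal.span {kollarPoly k p q}) (MvPolynomial.X 1) ∈ kollarPoint k p q := by
  apply Ideal.mem_map_of_mem
  change MvPolynomial.X 1 ∈ RingHom.ker (pointHom k p)
  rw [RingHom.mem_ker]
  exact pointHom_X_one k p

/-- **The 1-form `dt` vanishes at Kollár's point** (any field `k` of characteristic `p`, `q > 1`; `B` any model of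
the local ring `A_P`, i.e. a localization of `A` at `P` carrying the compatible `k(t)`- and `k`-algebra structures):
in `κ(B) ⊗ Ω_{B/k}`, `1 ⊗ d(t) = 0`, since `t = x^p − y^q` gives `dt = −q y^{q−1} dy` with `y ∈ 𝔪_B`.
[cite: Kollar2007, 1.19 (Curves over nonperfect fields)] -/
theorem tmul_D_t_eq_zero [CharP k p] [hq : Fact (1 < q)] (B : Type) [CommRing B] [IsLocalRing B]
    [Algebra (kollarRing k p q) B] [IsLocalization.AtPrime B (kollarPoint k p q)] [Algebra (RatFunc k) B]
    [IsScalarTower (RatFunc k) (kollarRing k p q) B] [Algebra k B] [IsScalarTower k (RatFunc k) B] :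
    (1 : ResidueField B) ⊗ₜ[B]
      KaehlerDifferential.D k B (algebraMap (RatFunc k) B RatFunc.X) = 0 := by
  set x : B := algebraMap (kollarRing k p q) B
    (Ideal.Quotient.mk (Ideal.span {kollarPoly k p q}) (MvPolynomial.X 0)) with hx
  set y : B := algebraMap (kollarRing k p q) B
    (Ideal.Quotient.mk (Ideal.span {kollarPoly k p q}) (MvPolynomial.X 1)) with hy
  -- `t = x^p − y^q` in `B`
  have ht : algebraMap (RatFunc k) B RatFunc.X = x ^ p - y ^ q := by
    rw [IsScalarTower.algebraMap_apply (RatFunc k) (kollarRing k p q) B, algebraMap_X_eq,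
      RingHom.map_sub, RingHom.map_pow, RingHom.map_pow]
  -- characteristic `p`
  haveI : CharP B p := charP_of_injective_algebraMap (algebraMap (RatFunc k) B).injective p
  -- `dt = p x^{p-1} dx − q y^{q−1} dy = −(q y^{q−1}) • dy`
  have hD : KaehlerDifferential.D k B (algebraMap (RatFunc k) B RatFunc.X) =
      -(((q : B) * y ^ (q - 1)) • KaehlerDifferential.D k B y) := by
    rw [ht, map_sub, Derivation.leibniz_pow, Derivation.leibniz_pow, ← Nat.cast_smul_eq_nsmul B p,
      ← Nat.cast_smul_eq_nsmul B q, smul_smul, smul_smul, CharP.cast_eq_zero B p, zero_mul, zero_smul, zero_sub]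
  -- `y ∈ 𝔪_B`, so the coefficient dies in `κ(B)`
  have hy𝔪 : y ∈ maximalIdeal B :=
    (IsLocalization.AtPrime.to_map_mem_maximal_iff B (kollarPoint k p q) _).mpr (mk_X_one_mem_kollarPoint k p q)
  have hcoef : ((q : B) * y ^ (q - 1)) ∈ maximalIdeal B := by
    refine Ideal.mul_mem_left _ _ (Ideal.pow_mem_of_mem _ hy𝔪 (q - 1) ?_)
    have := hq.out
    omega
  have hres : ((q : B) * y ^ (q - 1)) • (1 : ResidueField B) = 0 := by
    rw [Algebra.smul_def, mul_one]
    exact (IsLocalRing.residue_eq_zero_iff _).mpr hcoef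
  rw [hD, TensorProduct.tmul_neg, neg_eq_zero, ← TensorProduct.smul_tmul, hres, TensorProduct.zero_tmul]

/-- **(E6) read on the witness: `A_P` is not formally smooth over `k(t)`** (`k` PERFECT of characteristic `p`,
`q > 1`; `B` any localization of `A` at `P` as above): `B` is regular (gen 3) and `dt` vanishes at its closed point, so
by `ratFunc_formallySmooth_iff_tmul_D_ne_zero` it is not formally smooth over `k(t)` — `P ∈ Z(dt)`, the non-smooth
locus. [cite: Kollar2007, 1.19 (Curves over nonperfect fields)] -/
theorem not_formallySmooth_of_isLocalization_kollarPoint [CharP k p] [PerfectField k] [Fact (1 < q)] (B : Type)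
    [CommRing B] [IsLocalRing B] [Algebra (kollarRing k p q) B] [IsLocalization.AtPrime B (kollarPoint k p q)]
    [Algebra (RatFunc k) B] [IsScalarTower (RatFunc k) (kollarRing k p q) B] [Algebra k B]
    [IsScalarTower k (RatFunc k) B] : ¬ Algebra.FormallySmooth (RatFunc k) B := by
  intro h
  -- `B ≅ A_P` is regular and essentially of finite type over `k(t)`
  haveI := isRegularLocalRing_kollarPoint k p q
  haveI : IsRegularLocalRing B :=
    @IsRegularLocalRing.of_ringEquiv (Localization.AtPrime (kollarPoint k p q)) _
      (isRegularLocalRing_kollarPoint k p q) B _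
      (IsLocalization.algEquiv (kollarPoint k p q).primeCompl (Localization.AtPrime (kollarPoint k p q)) B).toRingEquiv
  haveI : Algebra.EssFiniteType (kollarRing k p q) B :=
    Algebra.EssFiniteType.of_isLocalization (R := kollarRing k p q) (S := B) (kollarPoint k p q).primeCompl
  haveI : Algebra.EssFiniteType (RatFunc k) B := Algebra.EssFiniteType.comp (RatFunc k) (kollarRing k p q) B
  exact (ratFunc_formallySmooth_iff_tmul_D_ne_zero k B).mp h (tmul_D_t_eq_zero k p q B)

/-- **Tightness of the perfectness hypothesis in `formallySmooth_iff_isRegularLocalRing_of_perfectField`.** Over the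
IMPERFECT ground field `M = k(t)` (`k` perfect of characteristic `p`), the local ring `A_P` of Kollár's curve at its
inseparable point is a REGULAR local ring essentially of finite type over `M` which is NOT formally smooth over `M`:
«regular ⟹ formally smooth» needs the constants to be perfect. [cite: Kollar2007, 1.19 (Curves over nonperfect fields)] -/
theorem isRegularLocalRing_and_not_formallySmooth_kollarPoint [CharP k p] [PerfectField k] [Fact (1 < q)] :
    IsRegularLocalRing (Localization.AtPrime (kollarPoint k p q)) ∧
      Algebra.EssFiniteType (RatFunc k) (Localization.AtPrime (kollarPoint k p q)) ∧
        ¬ Algebra.FormallySmooth (RatFunc k) (Localization.AtPrime (kollarPoint k p q)) := by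
  refine ⟨isRegularLocalRing_kollarPoint k p q, ?_, ?_⟩
  · haveI : Algebra.EssFiniteType (kollarRing k p q) (Localization.AtPrime (kollarPoint k p q)) :=
      Algebra.EssFiniteType.of_isLocalization (R := kollarRing k p q)
        (S := Localization.AtPrime (kollarPoint k p q)) (kollarPoint k p q).primeCompl
    exact Algebra.EssFiniteType.comp (RatFunc k) (kollarRing k p q) _
  · exact not_formallySmooth_of_isLocalization_kollarPoint k p q (Localization.AtPrime (kollarPoint k p q))

end Summit.ResolutionOfSingularities.ResolutionOfSingularities.Theorems.CampaignW82.KollarCurveAnyField
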